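import Summits.QuantumFields.YangMills.Theorems.UnitScaleTiltHalvingHSiteTopH42Datum
import Summits.QuantumFields.YangMills.Theorems.UnitScaleTiltHalvingHSiteTopH42OfTower
import Summits.QuantumFields.YangMills.Theorems.UnitScaleTiltHalvingHSiteTopReadsFull
import HarnessLib

/-!
# `hP1room` PROGRAMME, design (D2) of the v2 composers (★★OWNER g28 2026-08-28T20:46Z): THE `H42` TEXT OF ✓`siteSizeRows_of_topRows` AT THE KNIT GAUGE FROM THE
# COMPOSER's OWN ROWS + THE SUPPLIED (top) ROW — so the per-site composers DROP their displayed `H42` socket and display `HTOP` (∀-closed) + numeric windows instead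

Route `UnitScaleTilt`, crux K1 child «MinimiserStabilityRegPr» (stmt-QuantumFields-19200), registered stub `stub_halvingStep` (`BirthV10`).  Cell `ym3-torus` (HUMAN RULING
D-0037: YM₃ on T³ is ladder rung R3 — NOT d = 4, NOT a mass gap, NOT the Clay problem), width seat `ym-ust-19200-w7` gen 5 (adapted from ★w3-20520 g7's HOME variant (ii′)
`H42_at_member`, with the member data `PlaqSmall ε₁ V` replaced by the supplied (top) row — the composer stays ε₁-free).  `--supports stmt-QuantumFields-19200 --as helper`;
THEOREMS ONLY (0 `def`, 0 `sorry`); count-neutral; nothing here claims `hMember`, `hSupUρ3`, the stub, the crux or the gap.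

WHAT.  ★★ `H42_of_rows`: from the member geometry, J3's three rows `hInAk hInAx htw` (the tower row at `α₁`), the datum `(u₁, W, A)` (`u₁` unitary, `W^{u₁} = U′`, the chart
with size `c₁` on `□_k`), the top step's Hermitian `λ′` with ✓p654110∕✓p657394's conjunct 4 (`‖λ′‖ ≤ α₄` on the sides touching `Ω j`, `Lʲη‖∇λ′‖ ≤ α₄`), the SUPPLIED top
row `‖log U̿^{(k)}((U♯)^{g′})‖ ≤ t` on the top constraint bonds, and numeric windows: ✓`siteSizeRows_of_topRows`' `H42` text at `g′ := ((u₁·e^{iλ′})∘rep)⁻¹·ĝJ`.  Proof: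
`λ′ ≤ α₄` on `□₀`, `‖λ′(z+e_ν) − λ′(z)‖ ≤ α₄L^{−k}` on `□_k` (every bond out of `Ω j` is a side touching it, `d ≥ 2`); (G5) ✓`topReadsFull_of_datum` gives the reads within
`r := e^{2α₄}((e^{c₁} − 1) + α₄L^{−k})`; ✓`H42_of_towerTop` concludes.  HONEST SCOPE: by-name composition; windows displayed; nothing of Prop. 3 or the stub is proved here.

References: T. Bałaban, CMP **99** (1985) 75–102 [Balaban1985RegularSpaces] ((1.42) p.83, Prop. 3 p.87, (1.35) p.82, (1.108) p.94, (1.131) p.99); CMP **98** (1985) 17–51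
[Balaban1985Averaging] ((97)–(100) p.32); CMP **102** (1985) 277–309 [Balaban1985Variational] ((152)–(156) pp.301–302).
-/

set_option autoImplicit false

noncomputable section

open scoped BigOperators Matrix.Norms.L2Operator
open NormedSpace
open Complex (I)

namespace Summit.QuantumFields.YangMills.Theorems.HalvingHSiteTopH42OfRows

open Literature.MathematicalPhysics.QuantumFieldTheory.Balaban1983to89
open T4Continuum
open Literature.MathematicalPhysics.QuantumFieldTheory.Balaban1983to89.T3ContinuumYM3Torus
open Literature.MathematicalPhysics.QuantumFieldTheory.Balaban1983to89.T3PrintedRegularMinimiser (regFibrePr)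
open MatrixLog (mlog)
open B5Eq118OneStroke (iterBlockOf)
open B7Prop1Explicit renaming Site → LSite
open B7Prop1Explicit (e)
open B7Prop2Explicit (unitaryUnits C0 c2' avgIter)
open B7Prop2SpecialUnitary (mem_specialUnitaryUnits specialUnitaryUnits_le_unitaryUnits)
open B7Prop3Flat (c3)
open B7Prop4Flat (C2 c4)
open B7Prop1Local (InBox loK bondHiK)
open B7Eq92Concrete (mgauge)
open B8Ineq130 (tlo thi)
open B8Ineq132 (InAk)
open B8Eq119TwistedAxial (Restr129 InAx)
open B8Eq131Cubes (cube gs tLo tHi)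
open B8Eq131CubesAdmissible (cubeFam)
open B8CubeMemberZd (cubeLamS cubeLamB)
open B8Eq184Proof (gaugeExp cfgExp)
open B8Eq140Level (SideTouches)
open B8Ineq132 (covDerivFwd)
open B8LambdaSpaceKLevel (wt)
open B8Eq146AExpansion (iEta)
open B8Eq138LandauZd (IsLandau138W)
open B7Prop4GeneralLevels (logCovIter)
open B10Eq27TorusAxialLog (rel pull unitsField toUField suIncl gaugeActT axialT)
open B15Eq112TorusCover (lift cover)
open Node00 (coverAt)
open Summit.QuantumFields.YangMills.Theorems.Prop8ChartDoubleBar (dbarIterU vframeU)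
open Summit.QuantumFields.YangMills.Theorems (FlatMinimizerH.le_T3)
open HalvingHSiteTopH42Datum (ends_mem_cubeLamS_top)
open HalvingHSiteTopH42OfTower (H42_of_towerTop)
open HalvingHSiteTopReadsFull (topReadsFull_of_datum)
open HalvingHSiteTorusBlocks (rep_mem_cube_top_of_mem)
open P1FlatCoreTopLinearKnit (tgt_mk_coverAt)

variable (F : T3Family) {n K : ℕ}

/-- ★★ **THE `H42` TEXT FROM THE COMPOSER's ROWS** (design (D2), ★★OWNER g28 2026-08-28T20:46Z): ✓`H42_of_towerTop` ∘ (G5) ✓`topReadsFull_of_datum`, the reads row derived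
from the datum (`u₁` unitary, `W^{u₁} = U′`, the chart with size `c₁` on `□_k`), the top step's Hermitian `λ′` with its (1.108) sizes (`≤ α₄` on `□₀`, gradient `≤ α₄L^{−k}` on `□_k`),
and the SUPPLIED (top) row `htop` (budget `t`); windows numeric.  Conclusion = ✓`siteSizeRows_of_topRows`' `H42` binder at the knit gauge (the composers' former `H42 gJ hInAk hInAx g′`).
[cite: Balaban1985RegularSpaces, (1.42) p.83, Prop. 3 p.87, (1.35) p.82, (1.108) p.94, (1.131) p.99; Balaban1985Averaging, (97)-(100) p.32; Balaban1985Variational, (152)-(156) pp.301-302] -/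
theorem H42_of_rows (hd2 : 2 ≤ (F.P K).d) (hnK : n < K) (x₀ : Site (F.P K) 0) {a : LSite (F.P K).d} {M' ρ' : ℕ} (hρ' : (F.P K).L ≤ ρ')
    (ha : ∀ ν, a ν ≤ ((iterBlockOf (K - n) x₀ ν).val : ℤ) ∧ ((iterBlockOf (K - n) x₀ ν).val : ℤ) ≤ a ν + M' - 1)
    (hroomW : 2 * ((F.P K).L ^ (K - n) * (M' + 1) + ρ' * gs (F.P K).L (K - n)) ≤ (F.P K).sitesPerDir 0)
    {ε₀ : ℝ} (hε₀ : 0 < ε₀) (U : GaugeField (F.P K) 0 (Matrix.specialUnitaryGroup (Fin 2) ℂ))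
    -- J3's pre-gauge and its three rows
    (gJ : GaugeTransf (F.P K) 0 (Matrix.specialUnitaryGroup (Fin 2) ℂ)) {α₁ : ℝ}
    (hInAk : InAk (F.P K).L (K - n) (((F.L : ℝ)⁻¹) ^ (K - n)) ε₀ (fun _ => (Set.univ : Set (LSite (F.P K).d))) (pull (unitsField (toUField (GaugeField.gaugeAct gJ U))) 0))
    (hInAx : ∀ m', m' ≤ K - n → ∀ Λ : ℕ → Set (LSite (F.P K).d),
      InAx (F.P K).L m' Λ (1 : LSite (F.P K).d → Fin (F.P K).d → (Matrix (Fin 2) (Fin 2) ℂ)ˣ) (pull (unitsField (toUField (GaugeField.gaugeAct gJ U))) 0))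
    (htw : ∀ m', m' ≤ K - n → ∀ (x : LSite (F.P K).d) (ν : Fin (F.P K).d), tlo (F.P K).L (tLo a ρ') m' ≤ x → x + e ν ≤ thi (F.P K).L (tHi a M' ρ') m' →
      ‖((avgIter (F.P K).L (pull (unitsField (toUField (GaugeField.gaugeAct gJ U))) 0) (K - n - m') x ν : (Matrix (Fin 2) (Fin 2) ℂ)ˣ) :
          Matrix (Fin 2) (Fin 2) ℂ) - 1‖ < α₁)
    -- Theorem 4's datum in the member's letters
    {u₁ : LSite (F.P K).d → (Matrix (Fin 2) (Fin 2) ℂ)ˣ} {W : LSite (F.P K).d → Fin (F.P K).d → (Matrix (Fin 2) (Fin 2) ℂ)ˣ}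
    {A : LSite (F.P K).d → Fin (F.P K).d → Matrix (Fin 2) (Fin 2) ℂ}
    (hu₁ : ∀ x, u₁ x ∈ unitaryUnits (Matrix (Fin 2) (Fin 2) ℂ))
    (hW : mgauge (1 : LSite (F.P K).d → Fin (F.P K).d → (Matrix (Fin 2) (Fin 2) ℂ)ˣ) u₁ W = pull (unitsField (toUField (GaugeField.gaugeAct gJ U))) 0)
    {c₁ : ℝ} (hchartTop : ∀ z ∈ cube (F.P K).L a M' ρ' (K - n) (K - n), ∀ ν : Fin (F.P K).d,
      W z ν = cfgExp (((F.L : ℝ)⁻¹) ^ (K - n)) A z ν ∧ ((F.L : ℝ)⁻¹) ^ (K - n) * ‖A z ν‖ ≤ c₁)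
    -- the top step's `λ′`: Hermitian, and ✓`siteTopRows_of_sockets(_base)`' conjunct 4 («(1.108) sizes» on the sides touching every `Ω j`)
    {lam : LSite (F.P K).d → Matrix (Fin 2) (Fin 2) ℂ} {α₄ : ℝ} (hsa : ∀ x, IsSelfAdjoint (lam x))
    (h108 : ∀ j, j ≤ K - n → ∀ b ∈ {b : LSite (F.P K).d × Fin (F.P K).d | SideTouches (cubeFam false (F.P K).L a M' ρ' (K - n) j) b.1 b.2},
      ‖lam b.1‖ ≤ α₄ ∧ wt (F.P K).L (((F.L : ℝ)⁻¹) ^ (K - n)) j *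
        ‖covDerivFwd (((F.L : ℝ)⁻¹) ^ (K - n)) (1 : LSite (F.P K).d → Fin (F.P K).d → (Matrix (Fin 2) (Fin 2) ℂ)ˣ) b.2 lam b.1‖ ≤ α₄)
    -- the (top) row, SUPPLIED (the composer's displayed socket `HTOP` instantiated at its witnesses; the PACK closes it by ✓`htop_of_knitGauge`)
    {t : ℝ} (htop : ∀ c ∈ (cubeLamB (F.P K).L a M' ρ' (K - n) (K - n)) (K - n),
      ‖mlog ((dbarIterU (K - n) (gaugeActT (fun s => ((u₁ * gaugeExp lam) (lift (F.P K) x₀ + rel x₀ s))⁻¹ * Unitary.toUnits (suIncl (gJ s)) :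
          GaugeTransf (F.P K) 0 (Matrix (Fin 2) (Fin 2) ℂ)ˣ) (unitsField (toUField U)))
          ⟨coverAt (F.P K) (K - n) c.1, c.2⟩ : (Matrix (Fin 2) (Fin 2) ℂ)ˣ) : Matrix (Fin 2) (Fin 2) ℂ)‖ ≤ t)
    -- the composer's Prop-3 windows (VERBATIM) and the knit ∕ read ∕ (1.42) windows (window hand)
    {cstar : ℝ} (hα₁ : 0 < α₁) (hα₂ : 0 ≤ 2 * ((F.P K).L * cstar) + 8 * α₄)
    (hα3 : C0 (F.P K).d * ε₀ ≤ 1 / 3) (hα4 : 4 * ε₀ ≤ c2' (F.P K).d (F.P K).L)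
    (h16 : 16 * (2 * ((F.P K).L * cstar) + 8 * α₄) ≤ 1)
    (hsmallP : Real.exp (4 * (800 * (((F.P K).d : ℝ) + 1) ^ 2 * (((F.P K).d : ℝ) + 4)) * ε₀)
      * (1 + 8 * (131072 * (((F.P K).d : ℝ) + 1) ^ 2) * (2 * ((F.P K).L * cstar) + 8 * α₄)) ≤ 2)
    (hc₃P : 2 * (2 * ((F.P K).L * cstar) + 8 * α₄) ≤ c3 (F.P K).d (F.P K).L) (hsmall₁ : ((F.P K).d : ℝ) * (F.P K).L * α₁ ≤ 1 / 8)
    (hkb : 2 * ((F.P K).L * cstar) + 8 * α₄ ≤ c4 (F.P K).d)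
    (hbudget : 243200 * ((((F.P K).d + 2) * (F.P K).L : ℕ) : ℝ) ^ 2 * (2 * ((F.P K).L * cstar) + 8 * α₄) ≤ 1)
    (hr : Real.exp (2 * α₄) * ((Real.exp c₁ - 1) + α₄ * (((F.P K).L : ℝ) ^ (K - n))⁻¹) ≤ 1 / 2)
    (hr2 : 2 * (Real.exp (2 * α₄) * ((Real.exp c₁ - 1) + α₄ * (((F.P K).L : ℝ) ^ (K - n))⁻¹)) ≤ (2 * ((F.P K).L * cstar) + 8 * α₄) * (((F.P K).L : ℝ) ^ (K - n))⁻¹)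
    (hwin : t + (C2 (F.P K).d + 64 * 60800 * ((((F.P K).d + 2) * (F.P K).L : ℕ) : ℝ) ^ 2) * (2 * ((F.P K).L * cstar) + 8 * α₄) ^ 2 <
      2 * ((F.P K).d : ℝ) * (F.P K).L * α₁) :
    -- CONCLUSION: the `H42` argument of ✓`siteSizeRows_of_topRows` at the knit gauge (= the composers' `H42 gJ hInAk hInAx g′`)
    ∀ (u : LSite (F.P K).d → (Matrix (Fin 2) (Fin 2) ℂ)ˣ) (V' : LSite (F.P K).d → Fin (F.P K).d → (Matrix (Fin 2) (Fin 2) ℂ)ˣ)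
        (A' : LSite (F.P K).d → Fin (F.P K).d → (Matrix (Fin 2) (Fin 2) ℂ)),
      (∀ x, u x ∈ unitaryUnits (Matrix (Fin 2) (Fin 2) ℂ)) → mgauge (1 : LSite (F.P K).d → Fin (F.P K).d → (Matrix (Fin 2) (Fin 2) ℂ)ˣ) u V' = (pull (unitsField (toUField (GaugeField.gaugeAct gJ U))) 0) →
      Restr129 (F.P K).L (K - n) (Function.update (cubeLamS (F.P K).L a M' ρ' (K - n) (K - n)) (K - n) ∅) (1 : LSite (F.P K).d → Fin (F.P K).d → (Matrix (Fin 2) (Fin 2) ℂ)ˣ) u →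
      (IsLandau138W (F.P K).L (K - n) (((F.L : ℝ)⁻¹) ^ (K - n)) ((cubeFam false (F.P K).L a M' ρ' (K - n)) 0) (cubeLamS (F.P K).L a M' ρ' (K - n) (K - n)) (1 : LSite (F.P K).d → Fin (F.P K).d → (Matrix (Fin 2) (Fin 2) ℂ)ˣ) V' ∧
        (∀ c ∈ (cubeLamB (F.P K).L a M' ρ' (K - n) (K - n)) (K - n), ∀ (y : LSite (F.P K).d) (τ : Fin (F.P K).d),
          InBox (loK (F.P K).L (K - n) c.1) (bondHiK (F.P K).L (K - n) c.1 c.2) y → InBox (loK (F.P K).L (K - n) c.1) (bondHiK (F.P K).L (K - n) c.1 c.2) (y + e τ) →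
          V' y τ = gaugeActT (fun s => ((u₁ * gaugeExp lam) (lift (F.P K) x₀ + rel x₀ s))⁻¹ * Unitary.toUnits (suIncl (gJ s)) :
            GaugeTransf (F.P K) 0 (Matrix (Fin 2) (Fin 2) ℂ)ˣ) (unitsField (toUField U)) ⟨cover (F.P K) y, τ⟩)) →
      (∀ y τ, IsSelfAdjoint (A' y τ)) →
      (∀ j, j ≤ K - n → ∀ y τ, SideTouches ((cubeFam false (F.P K).L a M' ρ' (K - n)) j) y τ →
        V' y τ = cfgExp (((F.L : ℝ)⁻¹) ^ (K - n)) A' y τ ∧ ‖A' y τ‖ ≤ (2 * ((F.P K).L * cstar) + 8 * α₄) * (((F.P K).L : ℝ) ^ j * (((F.L : ℝ)⁻¹) ^ (K - n)))⁻¹) →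
      (∀ y τ, (∀ j, j ≤ K - n → ¬ SideTouches ((cubeFam false (F.P K).L a M' ρ' (K - n)) j) y τ) → A' y τ = 0) →
      ∀ j, j ≤ K - n → ∀ c ∈ (cubeLamB (F.P K).L a M' ρ' (K - n) (K - n)) j, ‖logCovIter (F.P K).L (1 : LSite (F.P K).d → Fin (F.P K).d → (Matrix (Fin 2) (Fin 2) ℂ)ˣ) (iEta (((F.L : ℝ)⁻¹) ^ (K - n)) A') j c.1 c.2‖ < 2 * (F.P K).d * (F.P K).L * α₁ := by
  have hk : K - n ≤ (F.P K).m + (F.P K).K := FlatMinimizerH.le_T3 F n K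
  have hL1 : 1 ≤ (F.P K).L := (F.P K).L_pos
  have hρ'1 : 1 ≤ ρ' := hL1.trans hρ'
  have hL0 : (0 : ℝ) < (F.L : ℝ) := by have := F.hL.2; exact_mod_cast (by omega : 0 < F.L)
  have hη : (0 : ℝ) < ((F.L : ℝ)⁻¹) ^ (K - n) := pow_pos (inv_pos.2 hL0) _
  have hLk : (0 : ℝ) < ((F.P K).L : ℝ) ^ (K - n) := pow_pos (by exact_mod_cast hL1) _
  -- every bond out of a point of `Ω j` is a side touching `Ω j` (`d ≥ 2`)
  have hST : ∀ (S : Set (LSite (F.P K).d)) (z : LSite (F.P K).d), z ∈ S → ∀ ν : Fin (F.P K).d, SideTouches S z ν := by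
    intro S z hz ν
    haveI : Nontrivial (Fin (F.P K).d) := Fin.nontrivial_iff_two_le.2 hd2
    obtain ⟨κ, hκ⟩ := exists_ne ν
    exact B8Eq140Level.sideTouches_of_bondTouches hκ (Or.inl hz)
  have hd0 : 0 < (F.P K).d := by omega
  -- `λ′ ≤ α₄` on `□₀` and its gradient `≤ α₄L^{−k}` on `□_k`, from the (1.108) sizes
  have hlam0 : ∀ z ∈ cube (F.P K).L a M' ρ' (K - n) 0, ‖lam z‖ ≤ α₄ := by
    intro z hz
    have hz' : z ∈ cubeFam false (F.P K).L a M' ρ' (K - n) 0 := by rwa [B8Eq131CubesAdmissible.cubeFam_false_of_le _ _ _ _ (Nat.zero_le _)]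
    exact (h108 0 (Nat.zero_le _) (z, ⟨0, hd0⟩) (hST _ z hz' _)).1
  have hgrad : ∀ z ∈ cube (F.P K).L a M' ρ' (K - n) (K - n), ∀ ν : Fin (F.P K).d, ‖lam (z + e ν) - lam z‖ ≤ α₄ * (((F.P K).L : ℝ) ^ (K - n))⁻¹ := by
    intro z hz ν
    have hz' : z ∈ cubeFam false (F.P K).L a M' ρ' (K - n) (K - n) := by rwa [B8Eq131CubesAdmissible.cubeFam_false_of_le _ _ _ _ le_rfl]
    have h := (h108 (K - n) le_rfl (z, ν) (hST _ z hz' ν)).2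
    simp only [wt, covDerivFwd, Pi.one_apply, B8Eq191FlatStencils.conjR_unitOne, norm_smul, norm_inv, Real.norm_of_nonneg hη.le] at h
    rw [le_mul_inv_iff₀ hLk, mul_comm]
    calc ((F.P K).L : ℝ) ^ (K - n) * ‖lam (z + e ν) - lam z‖
        = ((F.P K).L : ℝ) ^ (K - n) * ((F.L : ℝ)⁻¹) ^ (K - n) * ((((F.L : ℝ)⁻¹) ^ (K - n))⁻¹ * ‖lam (z + e ν) - lam z‖) := by
          field_simp
      _ ≤ α₄ := h
  -- the reads row: (G5) at the member (both `k`-blocks of a top constraint bond are top labels ⇒ representative in `□_k`)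
  have hreads : ∀ c ∈ (cubeLamB (F.P K).L a M' ρ' (K - n) (K - n)) (K - n), ∀ b : PBond (F.P K) 0,
      (iterBlockOf (K - n) b.src = (⟨coverAt (F.P K) (K - n) c.1, c.2⟩ : PBond (F.P K) (K - n)).src ∨
        iterBlockOf (K - n) b.src = (⟨coverAt (F.P K) (K - n) c.1, c.2⟩ : PBond (F.P K) (K - n)).tgt) →
      (iterBlockOf (K - n) b.tgt = (⟨coverAt (F.P K) (K - n) c.1, c.2⟩ : PBond (F.P K) (K - n)).src ∨
        iterBlockOf (K - n) b.tgt = (⟨coverAt (F.P K) (K - n) c.1, c.2⟩ : PBond (F.P K) (K - n)).tgt) →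
      ‖((gaugeActT (fun s => ((u₁ * gaugeExp lam) (lift (F.P K) x₀ + rel x₀ s))⁻¹ * Unitary.toUnits (suIncl (gJ s)) :
          GaugeTransf (F.P K) 0 (Matrix (Fin 2) (Fin 2) ℂ)ˣ) (unitsField (toUField U)) b : (Matrix (Fin 2) (Fin 2) ℂ)ˣ) : Matrix (Fin 2) (Fin 2) ℂ) - 1‖ ≤
        Real.exp (2 * α₄) * ((Real.exp c₁ - 1) + α₄ * (((F.P K).L : ℝ) ^ (K - n))⁻¹) := by
    intro c hc b hbs _
    obtain ⟨hc1mem, hc2mem⟩ := ends_mem_cubeLamS_top hL1 a M' ρ' (K - n) hc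
    have hT : iterBlockOf (K - n) b.src ∈ {B : Site (F.P K) (K - n) | ∃ yc ∈ cubeLamS (F.P K).L a M' ρ' (K - n) (K - n) (K - n), B = coverAt (F.P K) (K - n) yc} := by
      rcases hbs with h | h
      · exact ⟨c.1, hc1mem, h⟩
      · exact ⟨c.1 + e c.2, hc2mem, h.trans (tgt_mk_coverAt _ _ _)⟩
    exact topReadsFull_of_datum hnK x₀ hρ'1 ha hroomW U gJ hu₁ hW hη.le hchartTop hsa hlam0 hgrad b (rep_mem_cube_top_of_mem hk x₀ ha hroomW hT)
  -- the reshaped socket, instantiated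
  exact H42_of_towerTop F hnK hρ' U hε₀ hα₁ hα₂ hα3 hα4 h16 hsmallP hc₃P hsmall₁ hkb hbudget hr hr2 hwin gJ hInAk hInAx htw _ hreads htop

end Summit.QuantumFields.YangMills.Theorems.HalvingHSiteTopH42OfRows

end
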